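import Summits.HodgeConjecture.HodgeConjecture.Theorems.Ring2HypothesesDescentMotivatedCorrespondences
import Summits.HodgeConjecture.HodgeConjecture.Theorems.Ring2HypothesesDescentMotivatedRungs
import Summits.HodgeConjecture.HodgeConjecture.Theorems.Ring2HypothesesDescentAbsoluteIsogeny
import Literature.AlgebraicGeometry.HodgeTheory.HodgeConjectureAbelianSubquotients
import Literature.AlgebraicGeometry.Motives.AbelianVarietyQuotientOfJacobianHolds
import HarnessLib

/-!
# Ring 2 — hypotheses layer, descent axis: ROW b05 ON ISOGENY DIRECT SUMMANDS, ON FINITE PRODUCTS OF SIMPLE ABELIAN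
# VARIETIES (all degrees / middle degree) AND ON JACOBIANS — fact-free normal forms of `MotivatedImpliesAlgebraicAV`

HONEST FRAMING (page 1, verbatim the cell's standing line): **research route conditional on HC_CM; not a
corollary; Q11.4-sentence-2 already refuted in dim ≥ 3.** Nothing in this file proves a case of the Hodge conjecture;
nothing discharges the binder of record b05 `Ring2.Hypotheses.MotivatedImpliesAlgebraicAV` (`Ring2HypothesesDescent.lean`
:177; OPEN, «published modulo X»); the binder table's numbers do not move. `HC_CM` (`Theses.RankFourFaces.CMAbelianHodge`)
does not occur in this file; row b05 occurs only inside `↔` and is NOT asserted.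

Hodge ladder STAGE 3, `BINDER-OWNERS.md` row **b05**, seat `ring2-b05` (gen 40, file 3). Ring2-b06 gens 73–74 gave
`HC_AV` and row b06 their normal forms on finite products of simple abelian varieties and on Jacobians
(`hc_av_iff_productOfSimple`, `…_middleDegree`, `hc_av_iff_jacobians_of_quotientOfJacobian`; Literature
`HodgeConjectureAbelianSubquotients`: HC descends to isogeny direct summands). The MOTIVIC row b05 had none of them; they
are FACT-FREE here because motivated classes pull back along every morphism of smooth projective varieties (André
Prop. 2.1 (ii), gen 34's THEOREM `Theorems.map_mem_motivatedClasses`) — no chart or conjugation input as on the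
absolute road:

* §1 `motivatedClasses_le_algebraicClasses_of_comp_eq_nsmul_id` — **«motivated ⟹ algebraic» in codimension `p` passes
  from `J` to an isogeny direct summand `I`** (`t : I → J`, `h : J → I`, `t ≫ h = [n]`, `n ≠ 0`: `h^* c` is motivated on
  `J`, hence algebraic, so `t^* h^* c = n^{2p} c` is algebraic — van Geemen's Lemma 3.7 argument); hence to abelian
  subvarieties (`…_of_isClosedImmersion`, Poincaré), to quotients (`…_of_surjective_hom`), to factors (`…_of_prod_fst`).
* §2 **`motivatedImpliesAlgebraicAV_iff_productOfSimple` — ROW b05 ⟺ «motivated ⟹ algebraic» ON EVERY FINITE PRODUCT OF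
  SIMPLE complex abelian varieties** (Poincaré's complete reducibility, the tree's THEOREM
  `AbelianVariety.exists_isogeny_from_productOf_simple`); **`motivatedImpliesAlgebraicAV_iff_productOfSimple_middleDegree`
  — ROW b05 ⟺ the MIDDLE codimension `m` of every EVEN-dimensional (`2m ≥ 4`) finite product of simple abelian
  varieties** (the common refinement with gen 34's `motivatedImpliesAlgebraicAV_iff_forall_middleDegree`: the padding
  factor is a power of an elliptic curve, a product of simples; the upper half by Lieberman's algebraic `*_L`, gen 34's
  `motivatedClasses_le_algebraicClasses_abelianVariety_of_lower`; codimension `≤ 1` by the Lefschetz-range rung), `¬`-form.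
* §3 **`motivatedImpliesAlgebraicAV_iff_jacobians` — ROW b05 ⟺ «motivated ⟹ algebraic» ON THE JACOBIAN OF EVERY SMOOTH
  PROJECTIVE COMPLEX CURVE**, hypothesis-free (every complex abelian variety is a quotient of a Jacobian:
  Lange–Birkenhake Prop. 4.5.8 / Milne JV Thm. 10.1, the tree's THEOREM `langeBirkenhake1992_exists_jacobian_surjective_hom_holds`).

HONEST COLUMN. Nothing is discharged; row b05 stays OPEN and is NOT asserted; no definition, no named fact (new or
displayed), no sorry. NOT obtained: a reduction to SIMPLE abelian varieties (false direction: classes on products), a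
middle-degree Jacobian form (products of Jacobians are not Jacobians of smooth curves), bounds on the genus.

PRESEARCH: [corpus: book:green1994-algebraic-cycles-hodge-theory (van Geemen) §3.5–3.7 Lemma 3.7 p. 236 — isogeny
invariance of the Hodge `(p,p)` conjecture; MumfordAV1970 §19 Thm. 1; LangeBirkenhake1992 Prop. 4.5.8]; André 1996
Prop. 2.1 (ii) p. 14 (pull-backs of motivated cycles); no printed statement of the motivated normal forms found (corpus
+ galaxy, as in the gen's companions) — certification by assembly, no novelty in print claimed.

References (bib keys): Andre1996Motifs (Prop. 2.1 pp. 14–15, Thm. 0.6.2 p. 9, §6.2 p. 31), vanGeemen1994HodgeAV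
(§3.5–3.7 Lemma 3.7), MumfordAV1970 (§19 Thm. 1, Cor. 1, Remark p. 169), LangeBirkenhake1992 (Prop. 4.5.8, Cor. 2.4.24),
Milne1986JacobianVarieties (§10 Thm. 10.1), BrosnanFangNiePearlstein2009 (§6 Lemma 48), Lieberman1968 (main theorem),
Fulton1998 (§19.2 Cor. 19.2 (b)).
-/

noncomputable section

set_option linter.dupNamespace false

open CategoryTheory AlgebraicGeometry MonoidalCategory CartesianMonoidalCategory
open Literature.AlgebraicGeometry Literature.AlgebraicGeometry.Motives
open Literature.AlgebraicGeometry.Motives.AbelianVariety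
open Literature.AlgebraicGeometry.HodgeTheory
open Summit.HodgeConjecture.HodgeConjecture.Theorems

namespace Summit.HodgeConjecture.HodgeConjecture.Ring2.Hypotheses

/-! ## §1 Isogeny direct summands, abelian subvarieties, quotients, factors -/

section Summands

variable {I J : AbelianVariety ℂ}

/-- **«Motivated ⟹ algebraic» in codimension `p` passes to an isogeny direct summand**: if `t : I → J`, `h : J → I`
satisfy `t ≫ h = [n]` with `n ≠ 0` and `A_motᵖ(J)_ℂ ⊆ Nᵖ(J)`, then `A_motᵖ(I)_ℂ ⊆ Nᵖ(I)` — for `c ∈ A_motᵖ(I)`,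
`h^* c ∈ A_motᵖ(J)` (André Prop. 2.1 (ii), the tree's `Theorems.map_mem_motivatedClasses`) is algebraic, so
`t^* h^* c = n^{2p} • c` is algebraic (pull-back of algebraic classes into an abelian variety,
`map_mem_algebraicClasses_of_abelianVariety`), and `n^{2p} ≠ 0`. The hypothesis on `J` is NOT asserted.
[cite: Andre1996Motifs, Prop. 2.1 (ii) (p. 14)] [cite: vanGeemen1994HodgeAV, §3.6–3.7 Lemma 3.7 (p. 236)]
[cite: MumfordAV1970, §19 Remark p. 169] -/
theorem motivatedClasses_le_algebraicClasses_of_comp_eq_nsmul_id (t : I ⟶ J) (h : J ⟶ I) {n : ℕ} (hn : n ≠ 0)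
    (hth : t ≫ h = n • 𝟙 I) {p : ℕ} (hJ : motivatedClasses J.dim J.X p ≤ algebraicClasses J.X p) :
    motivatedClasses I.dim I.X p ≤ algebraicClasses I.X p := by
  intro c hc
  have hI : IsSmoothProjective I.dim I.X := AbelianVariety.isSmoothProjective_holds
  have hJsp : IsSmoothProjective J.dim J.X := AbelianVariety.isSmoothProjective_holds
  -- `h^* c` is motivated on `J`, hence algebraic
  have h1 : complexBetti.map h.hom.hom.hom (2 * p) c ∈ algebraicClasses J.X p :=
    hJ (map_mem_motivatedClasses h.hom.hom.hom hI hJsp p hc)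
  -- its pull-back along `t` is algebraic on `I` and equals `n^{2p} • c`
  have h2 : complexBetti.map t.hom.hom.hom (2 * p) (complexBetti.map h.hom.hom.hom (2 * p) c) ∈
      algebraicClasses I.X p :=
    map_mem_algebraicClasses_of_abelianVariety hI J t.hom.hom.hom h1
  rw [complexBetti_map_map_of_comp_eq_nsmul_id hth] at h2
  have hn' : ((n : ℂ) ^ (2 * p)) ≠ 0 := pow_ne_zero _ (Nat.cast_ne_zero.2 hn)
  have h3 := Submodule.smul_mem (algebraicClasses I.X p) (((n : ℂ) ^ (2 * p))⁻¹) h2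
  rwa [smul_smul, inv_mul_cancel₀ hn', one_smul] at h3

/-- **… to abelian subvarieties** (`ι : I ↪ J` a homomorphism and closed immersion: Poincaré's complete reducibility
gives `ι ≫ q = [n]`, the tree's `AbelianVariety.exists_comp_eq_nsmul_id_of_isClosedImmersion`).
[cite: MumfordAV1970, §19 Thm. 1 (pp. 173–174)] [cite: Andre1996Motifs, Prop. 2.1 (ii) (p. 14)] -/
theorem motivatedClasses_le_algebraicClasses_of_isClosedImmersion (ι : I ⟶ J)
    [IsClosedImmersion (Hom.toSchemeHom ι)] {p : ℕ} (hJ : motivatedClasses J.dim J.X p ≤ algebraicClasses J.X p) :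
    motivatedClasses I.dim I.X p ≤ algebraicClasses I.X p := by
  obtain ⟨q, n, hn, hq⟩ := exists_comp_eq_nsmul_id_of_isClosedImmersion ι
  exact motivatedClasses_le_algebraicClasses_of_comp_eq_nsmul_id ι q hn hq hJ

/-- **… to quotient abelian varieties** (`h : J ↠ I` a surjective homomorphism of any dimensions: a quasi-section
`t ≫ h = [n]`, the tree's `AbelianVariety.exists_comp_eq_nsmul_id_of_surjective`; isogenies in particular).
[cite: MumfordAV1970, §19 Thm. 1 and Remark p. 169] [cite: Andre1996Motifs, Prop. 2.1 (ii) (p. 14)] -/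
theorem motivatedClasses_le_algebraicClasses_of_surjective_hom (h : J ⟶ I) [Surjective (Hom.toSchemeHom h)]
    {p : ℕ} (hJ : motivatedClasses J.dim J.X p ≤ algebraicClasses J.X p) :
    motivatedClasses I.dim I.X p ≤ algebraicClasses I.X p := by
  obtain ⟨t, n, hn, ht⟩ := exists_comp_eq_nsmul_id_of_surjective h
  exact motivatedClasses_le_algebraicClasses_of_comp_eq_nsmul_id t h hn ht hJ

/-- **… to the factors of a product** (`(𝟙, 0) ≫ fst = 𝟙 = [1]`). [cite: vanGeemen1994HodgeAV, §3.6–3.7 Lemma 3.7 (p. 236)] -/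
theorem motivatedClasses_le_algebraicClasses_of_prod_fst {p : ℕ}
    (hIJ : motivatedClasses (I.prod J).dim (I.prod J).X p ≤ algebraicClasses (I.prod J).X p) :
    motivatedClasses I.dim I.X p ≤ algebraicClasses I.X p :=
  motivatedClasses_le_algebraicClasses_of_comp_eq_nsmul_id (AbelianVariety.prodLift (𝟙 I) 0) (AbelianVariety.fst I J)
    one_ne_zero (by rw [AbelianVariety.prodLift_fst, one_smul]) hIJ

end Summands

/-! ## §2 Row b05 on finite products of simple abelian varieties -/

section ProductOfSimple

/-- **ROW b05 ⟺ «MOTIVATED ⟹ ALGEBRAIC» ON EVERY FINITE PRODUCT OF SIMPLE COMPLEX ABELIAN VARIETIES** — fact-free: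
Poincaré's complete reducibility (`AbelianVariety.exists_isogeny_from_productOf_simple`: an isogeny `P → A` from a
product of simples, PROVED) and §1 for the surjection `P ↠ A`. Neither side is asserted.
[cite: MumfordAV1970, §19 Thm. 1 and Cor. 1 (pp. 173–174)] [cite: Andre1996Motifs, Prop. 2.1 (ii) (p. 14)] -/
theorem motivatedImpliesAlgebraicAV_iff_productOfSimple :
    MotivatedImpliesAlgebraicAV ↔
      ∀ P : AbelianVariety ℂ, AbelianVariety.IsProductOf AbelianVariety.IsSimple P →
        ∀ p : ℕ, motivatedClasses P.dim P.X p ≤ algebraicClasses P.X p := by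
  refine ⟨fun h P _ p ↦ h P p, fun h A p ↦ ?_⟩
  obtain ⟨P, g, hP, hg⟩ := AbelianVariety.exists_isogeny_from_productOf_simple A
  haveI : Surjective (Hom.toSchemeHom g) := hg.1
  exact motivatedClasses_le_algebraicClasses_of_surjective_hom g (h P hP p)

/-- **On a finite product `P` of simple abelian varieties, every motivated class is algebraic as soon as the MIDDLE
codimension of every EVEN-dimensional (`2m ≥ 4`) finite product of simple abelian varieties is** (fact-free):
`p ≤ 1` — the Lefschetz-range rung (`motivatedImpliesAlgebraicAV_of_lefschetzRange`); `2 ≤ p`, `2p + r = dim P`: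
`r = 0` is the hypothesis, `r ≥ 1` the product step with a power of an elliptic curve of dimension `r`
(`exists_productOfSimple_dim_eq_succ`, gen 34's `motivatedClasses_le_algebraicClasses_of_prod_middleDegree`);
`2p > dim P ≥ p` — Lieberman's algebraic `*_L` reflects the lower half (gen 34's
`motivatedClasses_le_algebraicClasses_abelianVariety_of_lower`); `p > dim P` — no classes. The hypothesis is NOT asserted.
[cite: BrosnanFangNiePearlstein2009, §6 Lemma 48] [cite: Lieberman1968, main theorem] [cite: Andre1996Motifs, §6.2 (p. 31)] -/
theorem motivatedClasses_le_algebraicClasses_productOfSimple_of_forall_middleDegree (P : AbelianVariety ℂ)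
    (hP : AbelianVariety.IsProductOf AbelianVariety.IsSimple P)
    (hmid : ∀ (Q : AbelianVariety ℂ) (m : ℕ), AbelianVariety.IsProductOf AbelianVariety.IsSimple Q → 2 ≤ m →
      Q.dim = 2 * m → motivatedClasses Q.dim Q.X m ≤ algebraicClasses Q.X m) (p : ℕ) :
    motivatedClasses P.dim P.X p ≤ algebraicClasses P.X p := by
  -- the half `2p ≤ dim P`
  have hle : ∀ p : ℕ, 2 * p ≤ P.dim → motivatedClasses P.dim P.X p ≤ algebraicClasses P.X p := by
    intro p h2p
    rcases Nat.lt_or_ge p 2 with hp | hp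
    · exact motivatedImpliesAlgebraicAV_of_lefschetzRange P (Or.inl (by omega))
    obtain ⟨r, hr⟩ : ∃ r, 2 * p + r = P.dim := ⟨P.dim - 2 * p, by omega⟩
    rcases r with _ | r'
    · exact hmid P p hP hp (by omega)
    · obtain ⟨B, hBs, hB⟩ := exists_productOfSimple_dim_eq_succ r'
      refine motivatedClasses_le_algebraicClasses_of_prod_middleDegree P B hr hB ?_
      have hd : (P.prod B).dim = 2 * (p + (r' + 1)) := by rw [AbelianVariety.dim_prod, hB]; omega
      have h := hmid (P.prod B) (p + (r' + 1)) (.prod hP hBs) (by omega) hd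
      rw [hd, AbelianVariety.prod_X] at h
      rwa [show P.dim + (r' + 1) = 2 * (p + (r' + 1)) by omega]
  rcases Nat.lt_or_ge P.dim (2 * p) with hlt | hge
  · rcases Nat.lt_or_ge P.dim p with hlt' | hge'
    · rw [motivatedClasses_eq_bot_of_lt hlt']
      exact bot_le
    · -- `p = (dim P - p) + j` with `2 (dim P - p) + j = dim P`: reflect the lower codimension `dim P - p`
      obtain ⟨j, hj⟩ : ∃ j, P.dim - p + j = p := ⟨2 * p - P.dim, by omega⟩
      have h := motivatedClasses_le_algebraicClasses_abelianVariety_of_lower P (p := P.dim - p) (j := j) (by omega)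
        (hle (P.dim - p) (by omega))
      rwa [hj] at h
  · exact hle p hge

/-- **ROW b05 ⟺ the motivated classes of the MIDDLE codimension `m` of every EVEN-dimensional (`2m ≥ 4`) FINITE PRODUCT
OF SIMPLE complex abelian varieties are algebraic** — fact-free; the common refinement of gen 34's
`motivatedImpliesAlgebraicAV_iff_forall_middleDegree` and of `motivatedImpliesAlgebraicAV_iff_productOfSimple`. Neither
side is asserted. [cite: MumfordAV1970, §19 Thm. 1 and Cor. 1 (pp. 173–174)] [cite: BrosnanFangNiePearlstein2009, §6 Lemma 48]
[cite: Andre1996Motifs, Thm. 0.6.2 (p. 9) and §6.2 (p. 31)] -/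
theorem motivatedImpliesAlgebraicAV_iff_productOfSimple_middleDegree :
    MotivatedImpliesAlgebraicAV ↔
      ∀ (Q : AbelianVariety ℂ) (m : ℕ), AbelianVariety.IsProductOf AbelianVariety.IsSimple Q → 2 ≤ m →
        Q.dim = 2 * m → motivatedClasses Q.dim Q.X m ≤ algebraicClasses Q.X m :=
  ⟨fun h Q m _ _ _ ↦ h Q m, fun h ↦ motivatedImpliesAlgebraicAV_iff_productOfSimple.2 fun P hP p ↦
    motivatedClasses_le_algebraicClasses_productOfSimple_of_forall_middleDegree P hP h p⟩

/-- **A counterexample to row b05, if any, can be taken in the middle codimension of an even-dimensional finite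
product of simple abelian varieties of dimension `≥ 4`** (the `¬`-form). Nothing is asserted about row b05.
[cite: MumfordAV1970, §19 Thm. 1 and Cor. 1 (pp. 173–174)] [cite: BrosnanFangNiePearlstein2009, §6 Lemma 48] -/
theorem not_motivatedImpliesAlgebraicAV_iff_exists_productOfSimple_middleDegree :
    ¬ MotivatedImpliesAlgebraicAV ↔
      ∃ (Q : AbelianVariety ℂ) (m : ℕ), AbelianVariety.IsProductOf AbelianVariety.IsSimple Q ∧ 2 ≤ m ∧
        Q.dim = 2 * m ∧ ¬ motivatedClasses Q.dim Q.X m ≤ algebraicClasses Q.X m := by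
  rw [motivatedImpliesAlgebraicAV_iff_productOfSimple_middleDegree]
  push Not
  exact Iff.rfl

end ProductOfSimple

/-! ## §3 Row b05 on Jacobians of curves -/

section Jacobians

/-- **ROW b05 ⟺ «MOTIVATED ⟹ ALGEBRAIC» ON THE JACOBIAN OF EVERY SMOOTH PROJECTIVE COMPLEX CURVE** — hypothesis-free:
every complex abelian variety `A` is a quotient `J(C) ↠ A` of a Jacobian (Lange–Birkenhake Prop. 4.5.8 / Milne JV
Thm. 10.1, the tree's THEOREM `langeBirkenhake1992_exists_jacobian_surjective_hom_holds`), and §1 descends along the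
surjection. `Jacobian C` is the tree's Albanese datum (`𝒥.J` its abelian variety). Neither side is asserted.
[cite: LangeBirkenhake1992, Prop. 4.5.8] [cite: Milne1986JacobianVarieties, §10 Thm. 10.1 (p. 198)]
[cite: Andre1996Motifs, Prop. 2.1 (ii) (p. 14)] -/
theorem motivatedImpliesAlgebraicAV_iff_jacobians :
    MotivatedImpliesAlgebraicAV ↔
      ∀ (C : SchemeOver ℂ), IsSmoothProjective 1 C → ∀ (𝒥 : Jacobian C) (p : ℕ),
        motivatedClasses 𝒥.J.dim 𝒥.J.X p ≤ algebraicClasses 𝒥.J.X p := by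
  refine ⟨fun h C _ 𝒥 p ↦ h 𝒥.J p, fun h A p ↦ ?_⟩
  obtain ⟨C, hC, 𝒥, φ, hφ⟩ := langeBirkenhake1992_exists_jacobian_surjective_hom_holds A
  haveI : Surjective (Hom.toSchemeHom φ) := hφ
  exact motivatedClasses_le_algebraicClasses_of_surjective_hom φ (h C hC 𝒥 p)

/-- **A counterexample to row b05, if any, can be taken on a Jacobian** (the `¬`-form). Nothing is asserted about
row b05. [cite: LangeBirkenhake1992, Prop. 4.5.8] [cite: Milne1986JacobianVarieties, §10 Thm. 10.1 (p. 198)] -/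
theorem not_motivatedImpliesAlgebraicAV_iff_exists_jacobian :
    ¬ MotivatedImpliesAlgebraicAV ↔
      ∃ C : SchemeOver ℂ, IsSmoothProjective 1 C ∧ ∃ (𝒥 : Jacobian C) (p : ℕ),
        ¬ motivatedClasses 𝒥.J.dim 𝒥.J.X p ≤ algebraicClasses 𝒥.J.X p := by
  rw [motivatedImpliesAlgebraicAV_iff_jacobians]
  push Not
  exact Iff.rfl

end Jacobians

/-! ## Audit: nothing is decided here

Every theorem above is an implication between per-variety instances of the OPEN row b05 or an equivalence between row
b05 and another OPEN statement; `MotivatedImpliesAlgebraicAV` is never proved, `HC_CM` / `HC_AV` do not occur. -/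

end Summit.HodgeConjecture.HodgeConjecture.Ring2.Hypotheses

end
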